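import Summits.NavierStokesRegularity.NavierStokesRegularity.Theses.SwallowedContinuum
import Summits.NavierStokesRegularity.NavierStokesRegularity.Theorems.HodographBetchovEquivalence
import Literature.Analysis.FluidPDE.TaoLocalisationHolds
import Literature.Analysis.FluidPDE.TaoLocalisationProofs
import Literature.Analysis.FluidPDE.AxisymmetricNoSwirlWeightedEnstrophyProofs

/-!
# `NoDiscSwallow` (stmt-NavierStokesRegularity-17612): placement relative to Clay (A)

Route `SwallowedContinuum`, deciding crux `NoDiscSwallow` (rank 2): along a classical solution of
unforced Navier–Stokes on `ℝ³ × [0,T)` that is Leray–Hopf from a rapidly decaying datum, no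
fibre `Xs⁻¹{x}` of the Lagrangian endpoint map `Xs = lim_{t↑T} X(t,·)` contains an embedded
closed 2-disc.

This file records, sorry-free, WHERE the crux sits (strategist r1, 2026-08-17):

* `endpoint_injective_of_hasSmoothExtensionPast` — if the solution extends classically past `T`
  then EVERY endpoint map `Xs` of its flow is injective: the extension is classical on the
  closed slab `[0,T]`, has energy `≤ 2E(u₀)` there (energy inequality for `t < T`, Fatou at
  `t = T`), hence bounded Sobolev norms of all orders (Tao 2013, Cor. 11.1 + Cor. 4.3 +
  Thm. 5.4 (iv), `tao2011_hasBoundedSobolevNormsOn_holds`), hence ONE spatial Lipschitz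
  constant for `u` on `[0,T)` (Sobolev imbedding applied to `Du`, mean value inequality); two
  labels with a common endpoint are then equal by Grönwall's inequality run backwards from
  `t₁ ↑ T` (`dist_le_of_trajectories_ODE_of_mem`).
* `noDiscSwallow_iff_noBlowup_membraneSector` — `NoDiscSwallow` is LITERALLY the no-blow-up
  statement restricted to the sector "some Lagrangian endpoint map swallows a 2-disc": the crux
  is a necessary condition for regularity whose whole content is the first-time blow-up
  scenario with membrane collapse; nothing short of excluding blow-up in that sector proves it.
* `noDiscSwallow_of_noBlowup`, `noDiscFreeCollapse_of_noBlowup`,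
  `noCollisionFreeBlowup_of_noBlowup` — consequently each of the route's three cruxes FOLLOWS
  from the no-blow-up statement (the `NoBlowup` packaging of Clay (A);
  `TypeICertificateLadder.NoBlowupToClay` is proved in tree), and
  `cruxes_of_navierStokesRegularity`, `noDiscSwallow_of_navierStokesRegularity` etc. — from
  Clay (A) itself (`HodographBetchov.noBlowup_of_navierStokesRegularity`).
* `navierStokesRegularity_iff_cruxes` — with the support item `EndpointMapExists` the three
  cruxes are JOINTLY EQUIVALENT to Clay (A): `→` is `cruxes_of_navierStokesRegularity`, `←` is
  the route's deciding theorem `SwallowedContinuum.closes` — an unassigned conjunct split of the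
  summit (tribunal T1′).

Crux workfile (strategist r1, `Cruxes/NoDiscSwallow/Placement.lean`); the same theorems without
the last one are proposed as `Theorems/SwallowedContinuumNoDiscSwallowPlacement.lean`
(`--supports stmt-NavierStokesRegularity-17612`). No Theses statement is asserted.
-/

noncomputable section

-- the summit and its single problem share the name `NavierStokesRegularity` (D-0017 nested layout)
set_option linter.dupNamespace false

namespace Summit.NavierStokesRegularity.NavierStokesRegularity.Cruxes.NoDiscSwallow.Placement

open Set MeasureTheory Filter Topology Metric Literature.Analysis.FluidPDE
open Summit.NavierStokesRegularity.NavierStokesRegularity.Theses.SwallowedContinuum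
open scoped ENNReal NNReal

/-! ### Step 1: a solution that extends past `T` is uniformly Lipschitz in space on `[0,T)` -/

/-- **Uniform spatial Lipschitz bound below a regular time.** Let `u` be Leray–Hopf on `[0,T)`
from the rapidly decaying datum `u 0` and let `(u',p')` be a classical extension to `[0,T')`,
`T' > T`, with `u' = u` on `[0,T)`. Then `u'` is classical on the closed slab `[0,T]` with energy
`≤ 2E(u 0)` (energy inequality for `t < T`, Fatou at `t = T`), so all its Sobolev norms are
bounded on `[0,T]` (Tao 2013, Cor. 11.1 + Cor. 4.3 + Thm. 5.4 (iv)); the Sobolev imbedding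
`H² ⊂ C_B` applied to `Du'` bounds the velocity gradient, and the mean value inequality gives one
Lipschitz constant for all slices `u t`, `t ∈ [0,T)`.
[cite: Tao2011, Cor. 11.1 + Cor. 4.3 + Thm. 5.4 (iv)] -/
theorem exists_lipschitzWith_of_hasSmoothExtensionPast {ν T : ℝ} (hν : 0 < ν) (hT : 0 < T)
    {u : ℝ → EuclideanSpace ℝ (Fin 3) → EuclideanSpace ℝ (Fin 3)}
    (hLH : IsLerayHopfOn T ν 0 (u 0) u) (hdec : HasRapidSpatialDecay (u 0))
    (hext : HasSmoothExtensionPast ν 0 u T) :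
    ∃ K : ℝ≥0, ∀ t ∈ Ico 0 T, LipschitzWith K (u t) := by
  obtain ⟨T', hT', u', p', hcl', hagree⟩ := hext
  -- the extension on the closed slab `[0,T]`
  have hUD : UniqueDiffOn ℝ (Icc 0 T) := uniqueDiffOn_Icc hT
  have hsol : IsClassicalNSSolutionOn (Icc 0 T) ν 0 u' p' :=
    hcl'.mono (Icc_subset_Ico_right hT') hUD
  -- energy bound `2 E(u 0)` on `[0,T)` transported to `u'`
  set E₀ : ℝ≥0∞ := ENNReal.ofReal (2 * VectorCalculus.kineticEnergy (u 0)) with hE₀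
  have hEt : ∀ t ∈ Ico 0 T, ∫⁻ x, ‖u' t x‖ₑ ^ 2 ≤ E₀ := by
    intro t ht
    rw [hagree t ht]
    exact hLH.lintegral_enorm_sq_le hν.le ⟨ht.1, ht.2.le⟩
  -- energy bound at `t = T` by Fatou along `tₙ ↑ T`
  have hET : ∫⁻ x, ‖u' T x‖ₑ ^ 2 ≤ E₀ := by
    set s : ℕ → ℝ := fun n => T - T / ((n : ℝ) + 2) with hs
    have hs_mem : ∀ n, s n ∈ Ico 0 T := by
      intro n
      have hn2 : (0 : ℝ) < (n : ℝ) + 2 := by positivity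
      have h1 : T / ((n : ℝ) + 2) ≤ T / 2 := by
        apply div_le_div_of_nonneg_left hT.le two_pos
        linarith [(Nat.cast_nonneg n : (0 : ℝ) ≤ n)]
      have h2 : 0 < T / ((n : ℝ) + 2) := div_pos hT hn2
      constructor
      · rw [hs]; dsimp only; linarith
      · rw [hs]; dsimp only; linarith
    have hs_tend : Tendsto s atTop (𝓝 T) := by
      have h1 : Tendsto (fun n : ℕ => T / ((n : ℝ) + 2)) atTop (𝓝 0) := by
        have h2 : Tendsto (fun n : ℕ => (n : ℝ) + 2) atTop atTop :=
          tendsto_atTop_add_const_right _ _ tendsto_natCast_atTop_atTop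
        exact h2.const_div_atTop T
      have := tendsto_const_nhds (x := T) |>.sub h1
      simpa [hs] using this
    have hcont : ContinuousOn (Function.uncurry u') (Ico 0 T' ×ˢ univ) :=
      hcl'.smooth_velocity.continuousOn
    have hptw : ∀ x, Tendsto (fun n => u' (s n) x) atTop (𝓝 (u' T x)) := by
      intro x
      have hTx : (T, x) ∈ Ico 0 T' ×ˢ (univ : Set (EuclideanSpace ℝ (Fin 3))) :=
        ⟨⟨hT.le, hT'⟩, mem_univ _⟩
      have hc := hcont (T, x) hTx
      have hseq : Tendsto (fun n => (s n, x)) atTop (𝓝[Ico 0 T' ×ˢ univ] (T, x)) := by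
        refine tendsto_nhdsWithin_iff.2 ⟨?_, Eventually.of_forall fun n => ?_⟩
        · exact (hs_tend.prodMk_nhds tendsto_const_nhds)
        · exact ⟨⟨(hs_mem n).1, (hs_mem n).2.trans hT'⟩, mem_univ _⟩
      exact hc.tendsto.comp hseq
    have hlim : ∀ x, ‖u' T x‖ₑ ^ 2 = liminf (fun n => ‖u' (s n) x‖ₑ ^ 2) atTop := by
      intro x
      have ht : Tendsto (fun n => ‖u' (s n) x‖ₑ ^ 2) atTop (𝓝 (‖u' T x‖ₑ ^ 2)) :=
        ((ENNReal.continuous_pow 2).tendsto _).comp (hptw x).enorm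
      exact ht.liminf_eq.symm
    have hmeas : ∀ n, AEMeasurable (fun x => ‖u' (s n) x‖ₑ ^ 2) volume := by
      intro n
      have hc : Continuous (u' (s n)) :=
        (hcl'.contDiff_velocity ⟨(hs_mem n).1, (hs_mem n).2.trans hT'⟩).continuous
      exact (hc.measurable.enorm.pow_const 2).aemeasurable
    calc ∫⁻ x, ‖u' T x‖ₑ ^ 2
        = ∫⁻ x, liminf (fun n => ‖u' (s n) x‖ₑ ^ 2) atTop :=
          lintegral_congr fun x => hlim x
      _ ≤ liminf (fun n => ∫⁻ x, ‖u' (s n) x‖ₑ ^ 2) atTop :=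
          lintegral_liminf_le' hmeas
      _ ≤ E₀ := by
          refine liminf_le_of_frequently_le' (Frequently.of_forall fun n => ?_)
          exact hEt (s n) (hs_mem n)
  have hE : ∃ C : ℝ≥0, ∀ t ∈ Icc 0 T, ∫⁻ x, ‖u' t x‖ₑ ^ 2 ≤ C := by
    refine ⟨E₀.toNNReal, fun t ht => ?_⟩
    rw [ENNReal.coe_toNNReal (by rw [hE₀]; exact ENNReal.ofReal_ne_top)]
    rcases ht.2.lt_or_eq with hlt | heq
    · exact hEt t ⟨ht.1, hlt⟩
    · rw [heq]; exact hET
  -- the datum of the extension is the rapidly decaying `u 0`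
  have hdec' : HasRapidSpatialDecay (u' 0) := by
    rw [hagree 0 ⟨le_rfl, hT⟩]
    exact hdec
  -- Tao: bounded Sobolev norms on `[0,T]`
  have hH : HasBoundedSobolevNormsOn (Icc 0 T) u' :=
    tao2011_hasBoundedSobolevNormsOn_holds hν hT hsol hE hdec'
  -- Sobolev imbedding applied to the gradient `D u'`: a uniform bound on `[0,T] × ℝ³`
  have hg : ∀ t ∈ Icc 0 T, ContDiff ℝ 2 (fderiv ℝ (u' t)) := by
    intro t ht
    have hu : ContDiff ℝ 3 (u' t) := (hsol.contDiff_velocity ht).of_le (by norm_cast)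
    exact hu.fderiv_right (m := 2) (by norm_num)
  have hHg : ∀ j < 3, ∃ C : ℝ≥0, ∀ t ∈ Icc 0 T,
      ∫⁻ x, ‖iteratedFDeriv ℝ j (fderiv ℝ (u' t)) x‖ₑ ^ 2 ≤ C := by
    intro j _
    obtain ⟨C, hC⟩ := hH (j + 1)
    refine ⟨C, fun t ht => le_of_eq_of_le (lintegral_congr fun x => ?_) (hC t ht)⟩
    rw [← ofReal_norm, norm_iteratedFDeriv_fderiv, ofReal_norm]
  obtain ⟨B, hB0, hB⟩ := exists_forall_norm_le_of_sobolev_bounds (S := Icc 0 T)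
    (g := fun t => fderiv ℝ (u' t)) hg hHg
  -- mean value inequality: one Lipschitz constant for all slices
  refine ⟨B.toNNReal, fun t ht => ?_⟩
  rw [← hagree t ht]
  have hdiff : Differentiable ℝ (u' t) :=
    (hsol.contDiff_velocity (Ico_subset_Icc_self ht)).differentiable (by simp)
  refine lipschitzWith_of_nnnorm_fderiv_le hdiff fun x => ?_
  rw [← NNReal.coe_le_coe, coe_nnnorm, Real.coe_toNNReal B hB0]
  exact hB t (Ico_subset_Icc_self ht) x

/-! ### Step 2: backward Grönwall — uniformly Lipschitz fields have injective endpoint maps -/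

/-- **Backward uniqueness through the endpoint.** If `u t` is `K`-Lipschitz for every
`t ∈ [0,T)`, `X` is a flow of `u` on `[0,T)` starting at the identity and `X(t,·) → Xs`
uniformly as `t ↑ T`, then `Xs` is injective: for `0 < t₁ < T`, Grönwall's inequality for
the time-reversed trajectories `s ↦ X(t₁ - s, a)`, `s ↦ X(t₁ - s, b)` of the field
`-u(t₁ - s, ·)` gives `dist a b ≤ dist (X t₁ a) (X t₁ b) · e^{K t₁}`, at most
`dist (X t₁ a) (X t₁ b) · e^{K T}`, and the right side tends to
`dist (Xs a) (Xs b) · e^{K T} = 0` as `t₁ ↑ T`.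
[folklore] -/
theorem injective_endpoint_of_lipschitz {T : ℝ} (hT : 0 < T)
    {u : ℝ → EuclideanSpace ℝ (Fin 3) → EuclideanSpace ℝ (Fin 3)} {K : ℝ≥0}
    (hK : ∀ t ∈ Ico 0 T, LipschitzWith K (u t))
    {X : ℝ → EuclideanSpace ℝ (Fin 3) → EuclideanSpace ℝ (Fin 3)}
    {Xs : EuclideanSpace ℝ (Fin 3) → EuclideanSpace ℝ (Fin 3)} (hX0 : ∀ a, X 0 a = a)
    (hode : ∀ a, ∀ t ∈ Ico 0 T, HasDerivWithinAt (fun s => X s a) (u t (X t a)) (Ico 0 T) t)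
    (hlim : TendstoUniformly X Xs (𝓝[<] T)) :
    Function.Injective Xs := by
  intro a b hab
  -- continuity of the trajectories on `[0,T)`
  have hcontX : ∀ c, ContinuousOn (fun s => X s c) (Ico 0 T) := fun c t ht =>
    (hode c t ht).continuousWithinAt
  -- the Grönwall estimate at every `t₁ ∈ (0,T)`
  have hgr : ∀ t₁ ∈ Ioo 0 T, dist a b ≤ dist (X t₁ a) (X t₁ b) * Real.exp (K * T) := by
    intro t₁ ht₁
    -- time-reversed trajectories and field on `[0, t₁]`
    set f : ℝ → EuclideanSpace ℝ (Fin 3) := fun s => X (t₁ - s) a with hf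
    set g : ℝ → EuclideanSpace ℝ (Fin 3) := fun s => X (t₁ - s) b with hg
    set v : ℝ → EuclideanSpace ℝ (Fin 3) → EuclideanSpace ℝ (Fin 3) :=
      fun s y => -(u (t₁ - s) y) with hv
    have hmaps : MapsTo (fun s : ℝ => t₁ - s) (Icc 0 t₁) (Ico 0 T) := fun s hs =>
      ⟨by linarith [hs.2], by linarith [hs.1, ht₁.2]⟩
    have hrev : ContinuousOn (fun s : ℝ => t₁ - s) (Icc 0 t₁) :=
      continuousOn_const.sub continuousOn_id
    have hfc : ContinuousOn f (Icc 0 t₁) := (hcontX a).comp hrev hmaps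
    have hgc : ContinuousOn g (Icc 0 t₁) := (hcontX b).comp hrev hmaps
    -- the reversed ODE at interior points (two-sided derivatives there)
    have hderiv : ∀ c, ∀ s ∈ Ico 0 t₁,
        HasDerivWithinAt (fun s => X (t₁ - s) c) (v s (X (t₁ - s) c)) (Ici s) s := by
      intro c s hs
      have h1 : 0 < t₁ - s := by linarith [hs.2]
      have h2 : t₁ - s < T := by linarith [hs.1, ht₁.2]
      have hd : HasDerivAt (fun r => X r c) (u (t₁ - s) (X (t₁ - s) c)) (t₁ - s) :=
        (hode c (t₁ - s) ⟨h1.le, h2⟩).hasDerivAt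
          (mem_of_superset (Ioo_mem_nhds h1 h2) Ioo_subset_Ico_self)
      have hh : HasDerivAt (fun r : ℝ => t₁ - r) (-1) s := by
        simpa using (hasDerivAt_id s).const_sub t₁
      have hcomp := hd.scomp s hh
      have : HasDerivAt (fun s => X (t₁ - s) c) (-(u (t₁ - s) (X (t₁ - s) c))) s := by
        simpa [Function.comp_def] using hcomp
      simpa [hv] using this.hasDerivWithinAt
    have hf' : ∀ s ∈ Ico 0 t₁, HasDerivWithinAt f (v s (f s)) (Ici s) s := fun s hs => by
      simpa [hf] using hderiv a s hs
    have hg' : ∀ s ∈ Ico 0 t₁, HasDerivWithinAt g (v s (g s)) (Ici s) s := fun s hs => by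
      simpa [hg] using hderiv b s hs
    -- the reversed field is `K`-Lipschitz
    have hvL : ∀ s ∈ Ico 0 t₁, LipschitzOnWith K (v s) univ := by
      intro s hs
      have hmem : t₁ - s ∈ Ico 0 T := ⟨by linarith [hs.2], by linarith [hs.1, ht₁.2]⟩
      refine (LipschitzWith.of_dist_le_mul fun x y => ?_).lipschitzOnWith
      rw [hv]
      dsimp only
      rw [dist_neg_neg]
      exact (hK (t₁ - s) hmem).dist_le_mul x y
    have hδ : dist (f 0) (g 0) ≤ dist (X t₁ a) (X t₁ b) := by simp [hf, hg]
    have hG := dist_le_of_trajectories_ODE_of_mem (s := fun _ => univ) hvL hfc hf'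
      (fun _ _ => mem_univ _) hgc hg' (fun _ _ => mem_univ _) hδ t₁ ⟨ht₁.1.le, le_rfl⟩
    have hfa : f t₁ = a := by simp [hf, hX0]
    have hgb : g t₁ = b := by simp [hg, hX0]
    rw [hfa, hgb, sub_zero] at hG
    refine hG.trans ?_
    have hKT : (K : ℝ) * t₁ ≤ K * T := mul_le_mul_of_nonneg_left ht₁.2.le K.coe_nonneg
    exact mul_le_mul_of_nonneg_left (Real.exp_le_exp.2 hKT) dist_nonneg
  -- pass to the limit `t₁ ↑ T`
  have hlimd : Tendsto (fun t₁ => dist (X t₁ a) (X t₁ b) * Real.exp (K * T)) (𝓝[<] T)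
      (𝓝 (dist (Xs a) (Xs b) * Real.exp (K * T))) :=
    ((hlim.tendsto_at a).dist (hlim.tendsto_at b)).mul_const _
  have hev : ∀ᶠ t₁ in 𝓝[<] T,
      dist a b ≤ dist (X t₁ a) (X t₁ b) * Real.exp (K * T) := by
    filter_upwards [Ioo_mem_nhdsLT hT] with t₁ ht₁ using hgr t₁ ht₁
  have hle : dist a b ≤ dist (Xs a) (Xs b) * Real.exp (K * T) := ge_of_tendsto hlimd hev
  rw [hab, dist_self, zero_mul] at hle
  exact dist_le_zero.1 hle

/-! ### Step 3: no disc in a fibre of an injective map -/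

/-- The closed unit disc of `ℝ²` has two distinct points. [folklore] -/
theorem two_points_closedBall :
    (0 : EuclideanSpace ℝ (Fin 2)) ∈ closedBall (0 : EuclideanSpace ℝ (Fin 2)) 1 ∧
    EuclideanSpace.single (0 : Fin 2) (1 : ℝ) ∈
      closedBall (0 : EuclideanSpace ℝ (Fin 2)) 1 ∧
    (0 : EuclideanSpace ℝ (Fin 2)) ≠ EuclideanSpace.single (0 : Fin 2) (1 : ℝ) := by
  refine ⟨by simp, by simp, ?_⟩
  intro h
  have := congrArg (fun v : EuclideanSpace ℝ (Fin 2) => v 0) h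
  simp at this

/-- A subsingleton contains no injectively and continuously embedded closed 2-disc.
[folklore] -/
theorem not_disc_of_subsingleton {A : Set (EuclideanSpace ℝ (Fin 3))} (hA : A.Subsingleton) :
    ¬ ∃ φ : EuclideanSpace ℝ (Fin 2) → EuclideanSpace ℝ (Fin 3),
      ContinuousOn φ (closedBall 0 1) ∧ InjOn φ (closedBall 0 1) ∧
      MapsTo φ (closedBall 0 1) A := by
  rintro ⟨φ, -, hinj, hmaps⟩
  obtain ⟨h0, h1, hne⟩ := two_points_closedBall
  exact hne (hinj h0 h1 (hA (hmaps h0) (hmaps h1)))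

/-- The fibres of an injective map are subsingletons. [folklore] -/
theorem subsingleton_fibre_of_injective
    {Xs : EuclideanSpace ℝ (Fin 3) → EuclideanSpace ℝ (Fin 3)} (h : Function.Injective Xs)
    (x : EuclideanSpace ℝ (Fin 3)) : (Xs ⁻¹' {x}).Subsingleton := fun a ha b hb => h (by
  simp only [mem_preimage, mem_singleton_iff] at ha hb
  rw [ha, hb])

/-! ### Step 4: the endpoint map of a solution that extends past `T` is injective -/

/-- **Regular time ⇒ injective endpoint map.** For a classical solution on `[0,T)` that is
Leray–Hopf from a rapidly decaying datum and extends classically past `T`, every Lagrangian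
endpoint map `Xs = lim_{t↑T} X(t,·)` of a flow `X` of `u` from the identity is injective
(Steps 1–2): no two fluid particles meet at a regular time, so no set with two points — let
alone a disc — is swallowed. [folklore] -/
theorem endpoint_injective_of_hasSmoothExtensionPast {ν T : ℝ} (hν : 0 < ν) (hT : 0 < T)
    {u : ℝ → EuclideanSpace ℝ (Fin 3) → EuclideanSpace ℝ (Fin 3)}
    (hLH : IsLerayHopfOn T ν 0 (u 0) u) (hdec : HasRapidSpatialDecay (u 0))
    (hext : HasSmoothExtensionPast ν 0 u T)
    {X : ℝ → EuclideanSpace ℝ (Fin 3) → EuclideanSpace ℝ (Fin 3)}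
    {Xs : EuclideanSpace ℝ (Fin 3) → EuclideanSpace ℝ (Fin 3)} (hX0 : ∀ a, X 0 a = a)
    (hode : ∀ a, ∀ t ∈ Ico 0 T, HasDerivWithinAt (fun s => X s a) (u t (X t a)) (Ico 0 T) t)
    (hlim : TendstoUniformly X Xs (𝓝[<] T)) :
    Function.Injective Xs := by
  obtain ⟨K, hK⟩ := exists_lipschitzWith_of_hasSmoothExtensionPast hν hT hLH hdec hext
  exact injective_endpoint_of_lipschitz hT hK hX0 hode hlim

/-! ### The crux is no-blow-up restricted to the membrane-swallowing sector -/

/-- **`NoDiscSwallow` is literally no-blow-up restricted to the membrane sector.** The right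
side says: every classical solution on `[0,T)`, Leray–Hopf from a rapidly decaying datum, one of
whose Lagrangian endpoint maps swallows an embedded closed 2-disc, extends classically past `T`.
`→`: under `NoDiscSwallow` that sector is empty. `←`: if a solution in the sector extended past
`T`, its endpoint map would be injective (`endpoint_injective_of_hasSmoothExtensionPast`) and
could swallow no disc. So the crux is decided by nothing short of excluding first-time blow-up
with membrane collapse (the blow-up scenario itself, in the sector containing the
axisymmetric-with-swirl candidates). [folklore] -/
theorem noDiscSwallow_iff_noBlowup_membraneSector :
    NoDiscSwallow ↔
      ∀ (ν T : ℝ), 0 < ν → 0 < T →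
        ∀ (u : ℝ → EuclideanSpace ℝ (Fin 3) → EuclideanSpace ℝ (Fin 3))
          (p : ℝ → EuclideanSpace ℝ (Fin 3) → ℝ),
        IsClassicalNSSolutionOn (Set.Ico 0 T) ν 0 u p → IsLerayHopfOn T ν 0 (u 0) u →
        HasRapidSpatialDecay (u 0) →
        ∀ (X : ℝ → EuclideanSpace ℝ (Fin 3) → EuclideanSpace ℝ (Fin 3))
          (Xs : EuclideanSpace ℝ (Fin 3) → EuclideanSpace ℝ (Fin 3)), (∀ a, X 0 a = a) →
        (∀ a, ∀ t ∈ Set.Ico 0 T,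
          HasDerivWithinAt (fun s => X s a) (u t (X t a)) (Set.Ico 0 T) t) →
        TendstoUniformly X Xs (𝓝[<] T) →
        (∃ x : EuclideanSpace ℝ (Fin 3),
          ∃ φ : EuclideanSpace ℝ (Fin 2) → EuclideanSpace ℝ (Fin 3),
          ContinuousOn φ (closedBall 0 1) ∧ InjOn φ (closedBall 0 1) ∧
          MapsTo φ (closedBall 0 1) (Xs ⁻¹' {x})) →
        HasSmoothExtensionPast ν 0 u T := by
  constructor
  · intro h ν T hν hT u p hcl hLH hdec X Xs hX0 hode hlim hdisc
    obtain ⟨x, φ, hφ⟩ := hdisc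
    exact absurd ⟨φ, hφ⟩ (h ν T hν hT u p hcl hLH hdec X Xs hX0 hode hlim x)
  · intro h ν T hν hT u p hcl hLH hdec X Xs hX0 hode hlim x hdisc
    have hext : HasSmoothExtensionPast ν 0 u T :=
      h ν T hν hT u p hcl hLH hdec X Xs hX0 hode hlim ⟨x, hdisc⟩
    have hinj :=
      endpoint_injective_of_hasSmoothExtensionPast hν hT hLH hdec hext hX0 hode hlim
    exact not_disc_of_subsingleton (subsingleton_fibre_of_injective hinj x) hdisc

/-! ### Placement: each crux follows from no blow-up, hence from Clay (A) -/

/-- **No blow-up ⇒ `NoDiscSwallow`.** If every classical solution of unforced Navier–Stokes on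
`ℝ³ × [0,T)` that is Leray–Hopf from a rapidly decaying datum extends classically past `T`
(the `NoBlowup` packaging of Clay (A): hypothesis of the proved
`TypeICertificateLadder.NoBlowupToClay`, conclusion of
`HodographBetchov.noBlowup_of_navierStokesRegularity`), then `NoDiscSwallow` holds — the
membrane sector of `noDiscSwallow_iff_noBlowup_membraneSector` is covered a fortiori. The crux
is a necessary condition for regularity; its whole content is the first-time blow-up scenario.
[folklore] -/
theorem noDiscSwallow_of_noBlowup
    (hNB : ∀ (ν T : ℝ), 0 < ν → 0 < T →
      ∀ (u : ℝ → EuclideanSpace ℝ (Fin 3) → EuclideanSpace ℝ (Fin 3))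
        (p : ℝ → EuclideanSpace ℝ (Fin 3) → ℝ),
      IsClassicalNSSolutionOn (Set.Ico 0 T) ν 0 u p → IsLerayHopfOn T ν 0 (u 0) u →
      HasRapidSpatialDecay (u 0) → HasSmoothExtensionPast ν 0 u T) :
    NoDiscSwallow :=
  noDiscSwallow_iff_noBlowup_membraneSector.2
    fun ν T hν hT u p hcl hLH hdec _ _ _ _ _ _ => hNB ν T hν hT u p hcl hLH hdec

/-- **No blow-up ⇒ `NoDiscFreeCollapse`.** Without blow-up every endpoint map is injective
(`endpoint_injective_of_hasSmoothExtensionPast`), every fibre is a subsingleton, and the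
hypothesis "a fibre with two labels" of the crux is never met. [folklore] -/
theorem noDiscFreeCollapse_of_noBlowup
    (hNB : ∀ (ν T : ℝ), 0 < ν → 0 < T →
      ∀ (u : ℝ → EuclideanSpace ℝ (Fin 3) → EuclideanSpace ℝ (Fin 3))
        (p : ℝ → EuclideanSpace ℝ (Fin 3) → ℝ),
      IsClassicalNSSolutionOn (Set.Ico 0 T) ν 0 u p → IsLerayHopfOn T ν 0 (u 0) u →
      HasRapidSpatialDecay (u 0) → HasSmoothExtensionPast ν 0 u T) :
    NoDiscFreeCollapse := by
  intro ν T hν hT u p hcl hLH hdec X Xs hX0 hode hlim x hx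
  have hinj := endpoint_injective_of_hasSmoothExtensionPast hν hT hLH hdec
    (hNB ν T hν hT u p hcl hLH hdec) hX0 hode hlim
  exact absurd (subsingleton_fibre_of_injective hinj x) hx

/-- **No blow-up ⇒ `NoCollisionFreeBlowup`** (the conclusion of the crux is the extension
itself; the injectivity hypothesis is not used). [folklore] -/
theorem noCollisionFreeBlowup_of_noBlowup
    (hNB : ∀ (ν T : ℝ), 0 < ν → 0 < T →
      ∀ (u : ℝ → EuclideanSpace ℝ (Fin 3) → EuclideanSpace ℝ (Fin 3))
        (p : ℝ → EuclideanSpace ℝ (Fin 3) → ℝ),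
      IsClassicalNSSolutionOn (Set.Ico 0 T) ν 0 u p → IsLerayHopfOn T ν 0 (u 0) u →
      HasRapidSpatialDecay (u 0) → HasSmoothExtensionPast ν 0 u T) :
    NoCollisionFreeBlowup :=
  fun ν T hν hT u p hcl hLH hdec _ _ _ _ _ _ => hNB ν T hν hT u p hcl hLH hdec

open _root_.Summit.NavierStokesRegularity.NavierStokesRegularity.Theorems in
/-- **NECESSITY of all three cruxes:
`NavierStokesRegularity → NoDiscSwallow ∧ NoDiscFreeCollapse ∧ NoCollisionFreeBlowup`.**
Clay (A) rules out blow-up (`HodographBetchov.noBlowup_of_navierStokesRegularity`, via the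
tree's `blowup_assembly` and the proved Clay-class uniqueness), and each crux follows from no
blow-up. Conversely the route's deciding theorem `SwallowedContinuum.closes` gives
`NoDiscSwallow → NoDiscFreeCollapse → NoCollisionFreeBlowup → EndpointMapExists →
NavierStokesRegularity`: given the support item `EndpointMapExists` the three cruxes are
JOINTLY EQUIVALENT to Clay (A) — an unassigned conjunct split of the summit (tribunal T1′).
[folklore] -/
theorem cruxes_of_navierStokesRegularity (hA : _root_.NavierStokesRegularity) :
    NoDiscSwallow ∧ NoDiscFreeCollapse ∧ NoCollisionFreeBlowup :=
  have hNB := HodographBetchov.noBlowup_of_navierStokesRegularity hA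
  ⟨noDiscSwallow_of_noBlowup hNB, noDiscFreeCollapse_of_noBlowup hNB,
    noCollisionFreeBlowup_of_noBlowup hNB⟩

/-- **NECESSITY: `NavierStokesRegularity → NoDiscSwallow`** (the deciding crux is a
consequence of the summit). [folklore] -/
theorem noDiscSwallow_of_navierStokesRegularity (hA : _root_.NavierStokesRegularity) :
    NoDiscSwallow :=
  (cruxes_of_navierStokesRegularity hA).1

/-- **NECESSITY: `NavierStokesRegularity → NoDiscFreeCollapse`.** [folklore] -/
theorem noDiscFreeCollapse_of_navierStokesRegularity (hA : _root_.NavierStokesRegularity) :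
    NoDiscFreeCollapse :=
  (cruxes_of_navierStokesRegularity hA).2.1

/-- **NECESSITY: `NavierStokesRegularity → NoCollisionFreeBlowup`.** [folklore] -/
theorem noCollisionFreeBlowup_of_navierStokesRegularity (hA : _root_.NavierStokesRegularity) :
    NoCollisionFreeBlowup :=
  (cruxes_of_navierStokesRegularity hA).2.2

/-- **With the endpoint map, the three cruxes ARE Clay (A).** Given the support item
`EndpointMapExists` (existence of the Lagrangian flow and its uniform endpoint limit along every
such solution), `NavierStokesRegularity ↔ NoDiscSwallow ∧ NoDiscFreeCollapse ∧
NoCollisionFreeBlowup`: `→` is `cruxes_of_navierStokesRegularity`, `←` is the route's deciding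
theorem `closes`. [folklore] -/
theorem navierStokesRegularity_iff_cruxes (hE : EndpointMapExists) :
    _root_.NavierStokesRegularity ↔ NoDiscSwallow ∧ NoDiscFreeCollapse ∧ NoCollisionFreeBlowup :=
  ⟨cruxes_of_navierStokesRegularity, fun h => closes h.1 h.2.1 h.2.2 hE⟩

end Summit.NavierStokesRegularity.NavierStokesRegularity.Cruxes.NoDiscSwallow.Placement

end
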